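import Literature.NumberTheory.Rogawski1990.AdelicStableConjugacyG2
import Literature.NumberTheory.Rogawski1990.AdelicInnerTransferProduct
import HarnessLib

/-!
# G1 — the `κ = 1` inner-transfer ASSEMBLY, adelic: `Φ^{st,𝐀}_{G′}(γ₀, f′) = Φ^{st,𝐀}_G(γ₀, f)` from the two Euler forms and the placewise
# inner-transfer product (Rogawski (1990), §14.2 (14.2.1) p. 232, §14.5 p. 238, §5.4 (5.4.3) pp. 72–73)

Topic `NumberTheory/Rogawski1990`; namespace `Literature.NumberTheory.Rogawski1990`; THEOREMS ONLY (no definition, no instance, no named fact,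
no `sorry`).  Row G1 of the T1 engine line's O11-0 census (PLAN-T1 (g4) §1): the ADELIC `κ = 1` identity between the stable orbital integral of the
inner form `G′ = U(H)` over its own adelic stable class `𝒞′_𝐀(γ₀)` (★ p08 `MatchingAdeleG₂.classes L H H γ₀`) and that of the quasi-split `G = U(Φ₃)`
over `𝒞_𝐀(γ₀)` (★ `MatchingAdeleG.classes L H γ₀`, ★ `adelicStableOrbitalIntegralG`), as a COMPOSITION of three ★∕☆ inputs and nothing else:
(i) the `G′`-side Euler form `Φ^{st,𝐀}_{G′} = Φ′^st_∞ · ∏_{v ∈ S} Φ′^st_v` eventually in `S` (p01's (G2)-kernel `MatchingAdeleG₂.exists_isEulerOnClasses_ofLocalAdelic…`,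
shape ★ `IsEulerOnClasses`), (ii) the `G`-side Euler form (★ E3t `MatchingAdeleG.exists_isEulerOnClasses_transport…`), (iii) the placewise product
`Φ′^st_∞ · ∏_{v ∈ S} Φ′^st_v = Φ^st_∞ · ∏_{v ∈ S} Φ^st_v` from (14.2.1) at every `v` and at `∞` (★ A-p16 `archStableOrbitalIntegral_mul_prod_base_eq_of_innerTransfer`).
The Euler forms enter as HYPOTHESES in exactly the ★ `IsEulerOnClasses` shape their providers conclude, so the file is measure-family-agnostic
(`mA′`, `mA` parameters) and the kit-level per-pin lemma is one `exact` over (i)(ii).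

* §1 `adelicStableOrbitalSum_eq_of_isEulerOnClasses_of_forall_mul_prod_eq` — ABSTRACT GLUE: two class sums (any groups `Γ′, Γ`, any class sets, any
  families) with Euler forms eventually in `S` over a common index type, whose Euler products agree for every `S`, are equal.
* §2 **`adelicStableOrbitalSum_classesSelf_eq_adelicStableOrbitalIntegralG_of_innerTransfer`** — G1: for `γ₀ ↔ γ` (`hγ : Corresponds (cmConjRingHom L) H Φ₃ γ₀ γ`,
  `hreg : IsRegularElt γ₀`), local∕archimedean factor data with `hloc : ∀ v, IsLocalInnerTransfer L H v (m′ v) (m v) (f′ v) (f v)` and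
  `harch : IsArchInnerTransfer L H mi′ mi a′ a`, and the two Euler-form hypotheses:
  `adelicStableOrbitalSum (MatchingAdeleG₂.classes L H H γ₀) mA′ F′ = adelicStableOrbitalIntegralG L H γ₀ mA F`.

## References
* J. D. Rogawski, *Automorphic Representations of Unitary Groups in Three Variables*, Ann. of Math. Stud. 123 (1990), §14.2 (14.2.1) p. 232, §14.5
  p. 238, §5.4 (5.4.3) pp. 72–73 [Rogawski1990].
-/

set_option autoImplicit false

noncomputable section

open MeasureTheory NumberField IsDedekindDomain

namespace Literature.NumberTheory.Rogawski1990

open Literature.NumberTheory.Automorphic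

/-! ## §1 Abstract glue: two eventual Euler forms with equal Euler products give equal class sums -/

section Glue

variable {Γ' Γ : Type*} [Group Γ'] [Group Γ]
  [∀ g : Γ', MeasurableSpace (Γ' ⧸ Subgroup.centralizer ({g} : Set Γ'))]
  [∀ g : Γ, MeasurableSpace (Γ ⧸ Subgroup.centralizer ({g} : Set Γ))]
  {ι : Type*} [DecidableEq ι]

/-- **GLUE**: if `Φ^st(𝒞′, f′) = arch′ · ∏_{i ∈ S} loc′ i` for all finite `S ⊇ S₁′`, `Φ^st(𝒞, f) = arch · ∏_{i ∈ S} loc i` for all finite `S ⊇ S₁`, and the two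
Euler products agree for EVERY finite `S`, then `Φ^st(𝒞′, f′) = Φ^st(𝒞, f)` (read both at `S := S₁′ ∪ S₁`). [cite: Rogawski1990, §14.5 p. 238] -/
theorem adelicStableOrbitalSum_eq_of_isEulerOnClasses_of_forall_mul_prod_eq
    {𝒞' : Set (ConjClasses Γ')} {m' : OrbitalMeasureFamily Γ'} {f' : Γ' → ℂ}
    {𝒞 : Set (ConjClasses Γ)} {m : OrbitalMeasureFamily Γ} {f : Γ → ℂ}
    {loc' loc : ι → ℂ} {arch' arch : ℂ}
    (h' : ∃ S₁' : Finset ι, ∀ S : Finset ι, S₁' ⊆ S → IsEulerOnClasses 𝒞' m' f' S loc' arch')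
    (h : ∃ S₁ : Finset ι, ∀ S : Finset ι, S₁ ⊆ S → IsEulerOnClasses 𝒞 m f S loc arch)
    (hprod : ∀ S : Finset ι, arch' * ∏ i ∈ S, loc' i = arch * ∏ i ∈ S, loc i) :
    adelicStableOrbitalSum 𝒞' m' f' = adelicStableOrbitalSum 𝒞 m f := by
  obtain ⟨S₁', h'⟩ := h'
  obtain ⟨S₁, h⟩ := h
  rw [(isEulerOnClasses_iff 𝒞' m' f' _ loc' arch').1 (h' (S₁' ∪ S₁) Finset.subset_union_left),
    (isEulerOnClasses_iff 𝒞 m f _ loc arch).1 (h (S₁' ∪ S₁) Finset.subset_union_right), hprod]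

end Glue

/-! ## §2 G1: the adelic `κ = 1` identity for the pair `(G′, G) = (U(H), U(Φ₃))` -/

section Assembly

variable {L : Type} [Field L] [NumberField L] [IsCMField L] {H : Matrix (Fin 3) (Fin 3) L}
  {γ₀ : (UnitaryGroup.cmDatum L 3 H).Rational}
  {γ : (UnitaryGroup.cmDatum L 3 (Matrix.of fun i j : Fin 3 => if i.val + j.val + 1 = 3 then (1 : L) else 0)).Rational}

variable
  [∀ (v : HeightOneSpectrum (𝓞 ↥(maximalRealSubfield L))) (x : (UnitaryGroup.cmDatum L 3 H).Local v),
    MeasurableSpace ((UnitaryGroup.cmDatum L 3 H).Local v ⧸ Subgroup.centralizer ({x} : Set ((UnitaryGroup.cmDatum L 3 H).Local v)))]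
  [∀ (v : HeightOneSpectrum (𝓞 ↥(maximalRealSubfield L)))
    (x : (UnitaryGroup.cmDatum L 3 (Matrix.of fun i j : Fin 3 => if i.val + j.val + 1 = 3 then (1 : L) else 0)).Local v),
    MeasurableSpace ((UnitaryGroup.cmDatum L 3 (Matrix.of fun i j : Fin 3 => if i.val + j.val + 1 = 3 then (1 : L) else 0)).Local v ⧸
      Subgroup.centralizer ({x} : Set ((UnitaryGroup.cmDatum L 3 (Matrix.of fun i j : Fin 3 => if i.val + j.val + 1 = 3 then (1 : L) else 0)).Local v)))]
  [∀ a : UnitaryGroup.arch (↥(maximalRealSubfield L)) L (IsCMField.complexConj L) 3 H,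
    MeasurableSpace (UnitaryGroup.arch (↥(maximalRealSubfield L)) L (IsCMField.complexConj L) 3 H ⧸
      Subgroup.centralizer ({a} : Set (UnitaryGroup.arch (↥(maximalRealSubfield L)) L (IsCMField.complexConj L) 3 H)))]
  [∀ a : UnitaryGroup.arch (↥(maximalRealSubfield L)) L (IsCMField.complexConj L) 3 (Matrix.of fun i j : Fin 3 => if i.val + j.val + 1 = 3 then (1 : L) else 0),
    MeasurableSpace (UnitaryGroup.arch (↥(maximalRealSubfield L)) L (IsCMField.complexConj L) 3 (Matrix.of fun i j : Fin 3 => if i.val + j.val + 1 = 3 then (1 : L) else 0) ⧸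
      Subgroup.centralizer ({a} : Set (UnitaryGroup.arch (↥(maximalRealSubfield L)) L (IsCMField.complexConj L) 3
        (Matrix.of fun i j : Fin 3 => if i.val + j.val + 1 = 3 then (1 : L) else 0))))]
  [∀ g : (UnitaryGroup.cmDatum L 3 H).Adelic,
    MeasurableSpace ((UnitaryGroup.cmDatum L 3 H).Adelic ⧸ Subgroup.centralizer ({g} : Set (UnitaryGroup.cmDatum L 3 H).Adelic))]
  [∀ g : (UnitaryGroup.cmDatum L 3 (Matrix.of fun i j : Fin 3 => if i.val + j.val + 1 = 3 then (1 : L) else 0)).Adelic,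
    MeasurableSpace ((UnitaryGroup.cmDatum L 3 (Matrix.of fun i j : Fin 3 => if i.val + j.val + 1 = 3 then (1 : L) else 0)).Adelic ⧸
      Subgroup.centralizer ({g} : Set (UnitaryGroup.cmDatum L 3 (Matrix.of fun i j : Fin 3 => if i.val + j.val + 1 = 3 then (1 : L) else 0)).Adelic))]

/-- **G1 — THE ADELIC `κ = 1` INNER-TRANSFER IDENTITY.**  `γ₀ ↔ γ` regular; local orbital measure families `m′_v` on `U(H)(L⁺_v)` and `m_v` on
`U(Φ₃)(L⁺_v)` with local factors `f′_v ↦ f_v` satisfying (14.2.1) at EVERY finite `v` (`hloc`, e.g. ★ F1 `forall_isLocalInnerTransfer_transport` for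
`m_v = (ψ_v)_* m′_v`, `f_v = f′_v ∘ ψ_v⁻¹`); archimedean families with (14.2.1) at `∞` (`harch`); ANY adelic class-indexed families `mA′` on
`U(H)(𝐀)`, `mA` on `U(Φ₃)(𝐀)` and adelic functions `F′`, `F` whose stable sums over `𝒞′_𝐀(γ₀)` ∕ `𝒞_𝐀(γ₀)` have the Euler forms with THOSE factors
eventually in `S` (`hG′`: p01's (G2)-kernel at `H₁ = H₂ = H`; `hG`: ★ E3t).  Then
`Φ^{st,𝐀}_{G′}(γ₀; mA′, F′) = Φ^{st,𝐀}_G(γ₀; mA, F)`. [cite: Rogawski1990, §14.2 (14.2.1) p. 232; §14.5 p. 238; §5.4 (5.4.3) pp. 72–73] -/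
theorem adelicStableOrbitalSum_classesSelf_eq_adelicStableOrbitalIntegralG_of_innerTransfer
    (m' : ∀ v : HeightOneSpectrum (𝓞 ↥(maximalRealSubfield L)), OrbitalMeasureFamily ((UnitaryGroup.cmDatum L 3 H).Local v))
    (m : ∀ v : HeightOneSpectrum (𝓞 ↥(maximalRealSubfield L)),
      OrbitalMeasureFamily ((UnitaryGroup.cmDatum L 3 (Matrix.of fun i j : Fin 3 => if i.val + j.val + 1 = 3 then (1 : L) else 0)).Local v))
    (mi' : OrbitalMeasureFamily (UnitaryGroup.arch (↥(maximalRealSubfield L)) L (IsCMField.complexConj L) 3 H))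
    (mi : OrbitalMeasureFamily (UnitaryGroup.arch (↥(maximalRealSubfield L)) L (IsCMField.complexConj L) 3
      (Matrix.of fun i j : Fin 3 => if i.val + j.val + 1 = 3 then (1 : L) else 0)))
    (f' : ∀ v : HeightOneSpectrum (𝓞 ↥(maximalRealSubfield L)), (UnitaryGroup.cmDatum L 3 H).Local v → ℂ)
    (f : ∀ v : HeightOneSpectrum (𝓞 ↥(maximalRealSubfield L)),
      (UnitaryGroup.cmDatum L 3 (Matrix.of fun i j : Fin 3 => if i.val + j.val + 1 = 3 then (1 : L) else 0)).Local v → ℂ)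
    (a' : UnitaryGroup.arch (↥(maximalRealSubfield L)) L (IsCMField.complexConj L) 3 H → ℂ)
    (a : UnitaryGroup.arch (↥(maximalRealSubfield L)) L (IsCMField.complexConj L) 3
      (Matrix.of fun i j : Fin 3 => if i.val + j.val + 1 = 3 then (1 : L) else 0) → ℂ)
    (hloc : ∀ v, IsLocalInnerTransfer L H v (m' v) (m v) (f' v) (f v)) (harch : IsArchInnerTransfer L H mi' mi a' a)
    (hγ : Corresponds (cmConjRingHom L) H (Matrix.of fun i j : Fin 3 => if i.val + j.val + 1 = 3 then (1 : L) else 0) γ₀ γ)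
    (hreg : IsRegularElt (γ₀.val : GL (Fin 3) L))
    (mA' : OrbitalMeasureFamily (UnitaryGroup.cmDatum L 3 H).Adelic) (F' : (UnitaryGroup.cmDatum L 3 H).Adelic → ℂ)
    (mA : OrbitalMeasureFamily (UnitaryGroup.cmDatum L 3 (Matrix.of fun i j : Fin 3 => if i.val + j.val + 1 = 3 then (1 : L) else 0)).Adelic)
    (F : (UnitaryGroup.cmDatum L 3 (Matrix.of fun i j : Fin 3 => if i.val + j.val + 1 = 3 then (1 : L) else 0)).Adelic → ℂ)
    (hG' : ∃ S₁' : Finset (HeightOneSpectrum (𝓞 ↥(maximalRealSubfield L))), ∀ S, S₁' ⊆ S →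
      IsEulerOnClasses (MatchingAdeleG₂.classes L H H γ₀) mA' F' S
        (fun v => localStableOrbitalIntegral L 3 H v (m' v) (f' v)
          ((UnitaryGroup.cmDatum L 3 H).toLocal v ((UnitaryGroup.cmDatum L 3 H).toAdelic γ₀)))
        (archStableOrbitalIntegral L 3 H mi' a' (cmRationalToArch L 3 H γ₀)))
    (hG : ∃ S₁ : Finset (HeightOneSpectrum (𝓞 ↥(maximalRealSubfield L))), ∀ S, S₁ ⊆ S →
      IsEulerOnClasses (MatchingAdeleG.classes L H γ₀) mA F S
        (fun v => localStableOrbitalIntegral L 3 (Matrix.of fun i j : Fin 3 => if i.val + j.val + 1 = 3 then (1 : L) else 0) v (m v) (f v)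
          ((UnitaryGroup.cmDatum L 3 (Matrix.of fun i j : Fin 3 => if i.val + j.val + 1 = 3 then (1 : L) else 0)).toLocal v
            ((UnitaryGroup.cmDatum L 3 (Matrix.of fun i j : Fin 3 => if i.val + j.val + 1 = 3 then (1 : L) else 0)).toAdelic γ)))
        (archStableOrbitalIntegral L 3 (Matrix.of fun i j : Fin 3 => if i.val + j.val + 1 = 3 then (1 : L) else 0) mi a
          (cmRationalToArch L 3 (Matrix.of fun i j : Fin 3 => if i.val + j.val + 1 = 3 then (1 : L) else 0) γ))) :
    adelicStableOrbitalSum (MatchingAdeleG₂.classes L H H γ₀) mA' F' = adelicStableOrbitalIntegralG L H γ₀ mA F := by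
  classical
  rw [adelicStableOrbitalIntegralG]
  exact adelicStableOrbitalSum_eq_of_isEulerOnClasses_of_forall_mul_prod_eq hG' hG
    (archStableOrbitalIntegral_mul_prod_base_eq_of_innerTransfer m' m mi' mi f' f a' a hloc harch hγ hreg)

end Assembly

end Literature.NumberTheory.Rogawski1990

end
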